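import Summits.QuantumFields.YangMills.Theses.BalabanUVNodes
import Summits.QuantumFields.YangMills.Theorems.BalabanUVNodesN27AtReadingOfRecord13CoPHHolderN16Sockets

/-!
# BalabanUVNodes ∕ N27 = binder B5 AT THE RECORD, route-facing leaf — K3⁷ `Theses.BalabanUVNodes.SpineGivenEndpointR13SepCoPH` AT THE ⁗ READING OF RECORD WITH NODE N16 IN ITS
# CURRENCY OF RECORD «R-β», THE N16 SLOT READ OFF NODE N05's FIVE SOCKETS AT EXPONENT `β` (pinned all-torus proper sub-index) + N07's LINEAR LEAF
# (module `…N27AtReadingOfRecord13CoPHHolderN16Sockets` §1 by name at `N = 2`, `Rg :=` the item's guard `θ.ZhUnity F 2 ∧ θ.SlotsNondegenerate₁₃ F 2`, through XXXVIᶜᵒᵖᴴ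
# `spine_rec13CCoPHOn_iff_forall_guarded` and `hc := hP.toCore` — leaf E `…N27SpineGivenEndpointR13SepCoPHHolder`'s SOCKETS twin, sibling of `…HolderN16Edges` (p586655); a route-facing leaf,
# nothing may import it)
# (cell `pub-ymgap`, HUMAN RULING D-0062 Track A; seat `pub-ymgap-dag-n17-w3` on row N27 (W-a) by plan g78∕g79 W-SEAT-START-LIST v4∕v5; `--kind proof --supports stmt-QuantumFields-20544 --as helper`;
# COUNT-NEUTRAL)

WHAT IS KERNEL-CHECKED ([bookkeeping]; ONE theorem, 0 `def`, 0 `sorry`): `spineGivenEndpointR13SepCoPH_at_readingOfRecord₁₃CoPHOn_holder_of_sockets : … → SpineGivenEndpointR13SepCoPH` — THE ITEM as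
a term under displayed hypotheses: a Hölder LETTER `β ∈ [0, 1]`, dag-n16-e 38ᴴ §2's N16 inputs at `N = 2` (`hg`; `hS` = per family a length letter, socket constants `C₂ B₀ B₀' cu cP B₀β`,
`inp : B8.B9Inputs` with their window, node N05's FIVE SOCKETS `SockP5base ∕ SockP5 ∕ SockH59 ∕ SockP5uE ∕ SockB9P3 (… β len …)` at `Matrix (Fin 2) (Fin 2) ℂ` on the pinned all-torus proper
sub-index; `h7` = node N07's `LeafH3sup`), N14 ∕ N15 ∕ N18 ∕ N22 ∕ (D4) in guarded θ-form on the residual data `ne1`, `ne2` and node00-def-W1's `w1`, the K5 stubs at the guarded spine home,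
the spine-side representation `hx`, the N19′ edge reading `RatesHolderAt … β` for every `ℓ₃` (every binder other than `hg ∕ hS` VERBATIM from leaf E's first theorem).

HONEST FRAMING.  NOT a discharge: a term of the item's type under displayed hypotheses (audit `proof.conditional`), each inhabited for no family today (K0⁷ OPEN); NE3 at exponent β
NOT PROVED; node N05's sockets and node N07's `LeafH3sup` are N05's ∕ N07's obligations; nothing of Bałaban's asserted or instantiated; N27 COMPOSITE, NOT discharged; K3⁷ NOT claimed;
route rev 25 and the skeleton of record UNTOUCHED; counts UNMOVED (typed 28∕28 · discharged 5∕27, A 5∕28); one finite four-torus programme at fixed `ε` — R4 closes the conditional rung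
`BalabanLadder.UV` only; NOT ℝ⁴, NOT infinite volume, NOT OS, NOT a mass gap, NOT Clay.  No decl below carries a cite tag.
-/

set_option autoImplicit false

namespace Summit.QuantumFields.YangMills.Theorems.BalabanUVNodesN27SpineRecord

open scoped Matrix.Norms.L2Operator

open Literature.MathematicalPhysics.QuantumFieldTheory.Balaban1983to89
open Literature.MathematicalPhysics.QuantumFieldTheory.Balaban1983to89.T4Continuum
open T4ContinuumYM4Torus (ForSmallCouplings)
open Summit.QuantumFields.BalabanUV.T4Continuum.Spine
open YMDAG.UVSplit
open Node00 (Stage13HParams datumOfRecord₁₃CoPH IsRecordOfRecord₁₃CCoPH IsDatumOfRecord₁₃CCoPH NE3Letters₁₁ NE2Objects₁₁ ne3ConstLayerOfRecord₁₁ MatA)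
open Node00.W1 (ReadingData)
open T4WeightBudget (RelWeightBound)
open T4IndicatorShell (ShellWeightBound)
open B7Prop1Explicit B7Prop2Explicit
open B7Prop3Flat (c3)
open B8LeafModelZd (ZdIdx SockP5base SockP5 SockH59)
open B8LeafModelZd3 (zdGF3 SockB9P3)
open B8LeafModelZdSockP5uE (SockP5uE)
open Node00 (ne3NperOfRecord₁₁ ne3DomOfRecord₁₁)
open Summit.QuantumFields.BalabanUV.T4Continuum.NE3.LeafIndexSockets (LeafH3sup)
open Summit.QuantumFields.YangMills.BalabanUVNodes.N16HolderDefs (N16HolderAt S_N16Holder)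
open Summit.QuantumFields.YangMills.BalabanUVNodes.SpineRatesHolder (RatesHolderAt)
open Summit.QuantumFields.YangMills.Theses.BalabanUVNodes (SpineGivenEndpointR13SepCoPH)

variable (cr₁₃ : SpineReading₁₃CoPH 2)
  (w1 : (F : T4Family) → (θ : Stage13HParams F 2) → Node00.W1.ReadingData F (Node00.MatA 2) θ.τ9.M)
  (ne2 : (F : T4Family) → Stage13HParams F 2 → (ℕ → ℝ) → List (ULoop F) → ℕ → NE2Objects₁₁)
  (ne1 : (F : T4Family) → Stage13HParams F 2 → (ℕ → ℝ) → List (ULoop F) → NE1pCarriers)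

/-- ★★ **K3⁷ AT THE ⁗ READING OF RECORD WITH NODE N16 IN ITS CURRENCY OF RECORD R-β, READ OFF NODE N05's FIVE SOCKETS AT EXPONENT `β` ON THE PINNED ALL-TORUS PROPER
SUB-INDEX + N07's LINEAR LEAF** (`N = 2`; XXXVIᶜᵒᵖᴴ `spine_rec13CCoPHOn_iff_forall_guarded` ∘ `spine_rec13CCoPHOn_at_readingOfRecord₁₃CoPH_holder_of_sockets` at `Rg :=` the item's guard,
`hc := hP.toCore`): leaf E's SOCKETS twin — the letters `ℓ₃` PRODUCED by dag-n16-e 38ᴴ §2 at exponent `β ∈ [0, 1]` (a LETTER; the consumers' window `2∕3 < β < 1` lies inside) from `hg`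
(coupling letter), `hS` (node N05's five sockets with constants and window) and `h7` (node N07's `LeafH3sup`), N14 ∕ N15 ∕ N18 ∕ N22 ∕ (D4) in guarded θ-form, the K5 stubs at the guarded
spine home, the spine-side representation `hx`, the N19′ edge reading `RatesHolderAt … β` for every `ℓ₃` — the guard reaching each.  NOT a discharge: a term of the item's type under
displayed hypotheses, each inhabited for no family today (K0⁷ OPEN); NE3 at exponent β NOT PROVED; N05 ∕ N07 ∕ N16 ∕ N27 NOT discharged. [bookkeeping] -/
theorem spineGivenEndpointR13SepCoPH_at_readingOfRecord₁₃CoPHOn_holder_of_sockets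
    {β : ℝ} (hβ0 : 0 ≤ β) (hβ1 : β ≤ 1) {g : T4Family → ℝ} (hg : ∀ F, 0 < g F)
    (hS : ∀ F : T4Family, letI : CStarAlgebra (Matrix (Fin 2) (Fin 2) ℂ) := {}
      ∃ (len : Site 4 → ℝ) (C₂ B₀ B₀' cu cP B₀β : ℝ) (inp : B8.B9Inputs),
        (∀ v : Site 4, 0 < len v → 1 ≤ len v) ∧ (∀ μ : Fin 4, len (e μ) = 1) ∧
        0 < B₀ ∧ inp.B₀ ≤ B₀ ∧ 0 < B₀' ∧ 2 ≤ 5 * ((4 : ℕ) : ℝ) * F.L * B₀ ∧ 0 < cu ∧ 0 < cP ∧ 0 ≤ B₀β ∧ 2097152 * (((4 : ℕ) : ℝ) + 1) ^ 2 ≤ C₂ ∧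
        (∀ i : {i : ZdIdx 4 F.L // (∀ j, i.Ω j = Set.univ) ∧ (∀ m j, i.Λs m j = {_y | j = m}) ∧ (∀ m j, i.Λb m j = {_c | j = m}) ∧ i.η = ((F.L : ℝ)⁻¹) ^ i.k}, SockP5base (𝔸 := Matrix (Fin 2) (Fin 2) ℂ) F.L B₀ B₀' cP i.1.η i.1.k i.1.Ω i.1.Λs) ∧
        (∀ i : {i : ZdIdx 4 F.L // (∀ j, i.Ω j = Set.univ) ∧ (∀ m j, i.Λs m j = {_y | j = m}) ∧ (∀ m j, i.Λb m j = {_c | j = m}) ∧ i.η = ((F.L : ℝ)⁻¹) ^ i.k}, SockP5 (𝔸 := Matrix (Fin 2) (Fin 2) ℂ) F.L B₀ B₀' cP i.1.η i.1.k i.1.Ω i.1.Λs) ∧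
        (∀ i : {i : ZdIdx 4 F.L // (∀ j, i.Ω j = Set.univ) ∧ (∀ m j, i.Λs m j = {_y | j = m}) ∧ (∀ m j, i.Λb m j = {_c | j = m}) ∧ i.η = ((F.L : ℝ)⁻¹) ^ i.k}, SockH59 (𝔸 := Matrix (Fin 2) (Fin 2) ℂ) F.L B₀ B₀' cP i.1.η i.1.k i.1.Ω i.1.Λs i.1.Λb) ∧
        (∀ i : {i : ZdIdx 4 F.L // (∀ j, i.Ω j = Set.univ) ∧ (∀ m j, i.Λs m j = {_y | j = m}) ∧ (∀ m j, i.Λb m j = {_c | j = m}) ∧ i.η = ((F.L : ℝ)⁻¹) ^ i.k}, SockP5uE (𝔸 := Matrix (Fin 2) (Fin 2) ℂ) F.L B₀ cP cu i.1.η i.1.k i.1.Ω i.1.Λs) ∧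
        (∀ i : {i : ZdIdx 4 F.L // (∀ j, i.Ω j = Set.univ) ∧ (∀ m j, i.Λs m j = {_y | j = m}) ∧ (∀ m j, i.Λb m j = {_c | j = m}) ∧ i.η = ((F.L : ℝ)⁻¹) ^ i.k}, SockB9P3 (𝔸 := Matrix (Fin 2) (Fin 2) ℂ) F.L inp.B₀ B₀β cP β len i.1.η i.1.k i.1.Ω i.1.Λs i.1.Λb))
    (h7 : ∀ F : T4Family, ∃ C ε₀ : ℝ, 0 ≤ C ∧ 0 < ε₀ ∧ ∀ ε : ℝ, 0 < ε → ε ≤ ε₀ →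
      LeafH3sup 4 F.L (ne3NperOfRecord₁₁ F 0 0) ε (C * ε) (C * ε) (ne3DomOfRecord₁₁ F 2 0 0))
    (h14 : ∀ (F : T4Family) (θ : Stage13HParams F 2), θ.Provisos₁₃CoPH F 2 → (θ.ZhUnity F 2 ∧ θ.SlotsNondegenerate₁₃ F 2) → θ.Admissible F 2 → ∀ (g₀ : ℕ → ℝ) (os : List (ULoop F)),
      N14At (ne1 F θ g₀ os))
    (h15 : ∀ (F : T4Family) (θ : Stage13HParams F 2), θ.Provisos₁₃CoPH F 2 → (θ.ZhUnity F 2 ∧ θ.SlotsNondegenerate₁₃ F 2) → θ.Admissible F 2 → ∀ (g₀ : ℕ → ℝ) (os : List (ULoop F)) (k : ℕ),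
      N15At (ne2OfRecord₁₁ (ne2 F θ g₀ os k)))
    (h18 : ∀ (F : T4Family) (θ : Stage13HParams F 2), θ.Provisos₁₃CoPH F 2 → (θ.ZhUnity F 2 ∧ θ.SlotsNondegenerate₁₃ F 2) → θ.Admissible F 2 → ∀ k : ℕ,
      N18At (u3OfRecord₁₃ θ.toStage13Params ((w1 F θ).u3Objects θ.γ) k))
    (h22 : ∀ (F : T4Family) (θ : Stage13HParams F 2), θ.Provisos₁₃CoPH F 2 → (θ.ZhUnity F 2 ∧ θ.SlotsNondegenerate₁₃ F 2) → θ.Admissible F 2 → ∀ k : ℕ,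
      N22At (u3OfRecord₁₃ θ.toStage13Params ((w1 F θ).u3Objects θ.γ) k))
    (hD4 : ∀ (F : T4Family) (θ : Stage13HParams F 2) (hP : θ.Provisos₁₃CoPH F 2), (θ.ZhUnity F 2 ∧ θ.SlotsNondegenerate₁₃ F 2) → θ.Admissible F 2 → ∀ k : ℕ,
      ReadOutAt (datumOfRecord₁₃CoPH F 2 θ hP) (u3OfRecord₁₃ θ.toStage13Params ((w1 F θ).u3Objects θ.γ) k))
    (h20 : S_N20 (SRec₁₃CoPHOn cr₁₃ fun F θ => θ.ZhUnity F 2 ∧ θ.SlotsNondegenerate₁₃ F 2)) (h21 : S_N21 (SRec₁₃CoPHOn cr₁₃ fun F θ => θ.ZhUnity F 2 ∧ θ.SlotsNondegenerate₁₃ F 2))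
    (hx : ∀ (F : T4Family) (θ : Stage13HParams F 2) (hP : θ.Provisos₁₃CoPH F 2), (θ.ZhUnity F 2 ∧ θ.SlotsNondegenerate₁₃ F 2) → θ.Admissible F 2 →
      B16.EndStatementBPrinted (datumOfRecord₁₃CoPH F 2 θ hP).C → DagBinding.EndpointExistence (datumOfRecord₁₃CoPH F 2 θ hP).C.toB12 →
        ForSmallCouplings (datumOfRecord₁₃CoPH F 2 θ hP) fun g₀ => ∀ os : List (ULoop F),
          0 < (cr₁₃ F θ hP g₀ os).l₀ ∧ 0 < (cr₁₃ F θ hP g₀ os).vol ∧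
          (∀ (K : ℕ) (t : ℝ), |t| ≤ (cr₁₃ F θ hP g₀ os).l₀ →
            T4GenFunBounds.schemeZ ((datumOfRecord₁₃CoPH F 2 θ hP).scheme g₀) os ((cr₁₃ F θ hP g₀ os).K₀ + K) t =
              ∑ τ ∈ (cr₁₃ F θ hP g₀ os).T K, (cr₁₃ F θ hP g₀ os).A K t τ) ∧
          (∀ (K : ℕ) (t : ℝ), |t| ≤ (cr₁₃ F θ hP g₀ os).l₀ →
            T4GenFunBounds.schemeZ ((datumOfRecord₁₃CoPH F 2 θ hP).scheme g₀) os ((cr₁₃ F θ hP g₀ os).K₀ + K + 1) t =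
              ∑ τ ∈ (cr₁₃ F θ hP g₀ os).T K, (cr₁₃ F θ hP g₀ os).B K t τ))
    (h19 : ∀ (ℓ₃ : T4Family → NE3Letters₁₁) (F : T4Family) (θ : Stage13HParams F 2) (hP : θ.Provisos₁₃CoPH F 2), (θ.ZhUnity F 2 ∧ θ.SlotsNondegenerate₁₃ F 2) → θ.Admissible F 2 → ∀ (g₀ : ℕ → ℝ) (os : List (ULoop F)),
      (∀ k : ℕ, RatesHolderAt (datumOfRecord₁₃CoPH F 2 θ hP) (rateCarriersOfRecord₁₃CoPH (readingOfRecord₁₃CoPH w1 ℓ₃ ne2 ne1) F θ hP g₀ os k) β) → letI := (cr₁₃ F θ hP g₀ os).dec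
        ∃ δ : ℕ → ℝ, NE7.Core (cr₁₃ F θ hP g₀ os).l₀ (cr₁₃ F θ hP g₀ os).vol (cr₁₃ F θ hP g₀ os).T (cr₁₃ F θ hP g₀ os).Bad
          (fun K t τ => (cr₁₃ F θ hP g₀ os).A K t τ - (cr₁₃ F θ hP g₀ os).shA K t τ) (fun K t τ => (cr₁₃ F θ hP g₀ os).B K t τ - (cr₁₃ F θ hP g₀ os).shB K t τ) δ ∧
          Summable δ) :
    SpineGivenEndpointR13SepCoPH :=
  fun F θ hP hG hθ _ _ =>
    (spine_rec13CCoPHOn_iff_forall_guarded fun F θ => θ.ZhUnity F 2 ∧ θ.SlotsNondegenerate₁₃ F 2).mp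
      (spine_rec13CCoPHOn_at_readingOfRecord₁₃CoPH_holder_of_sockets (cr := cr₁₃) hβ0 hβ1 (hg := hg) (hS := hS) (h7 := h7) (w1 := w1) (ne2 := ne2)
        (ne1 := ne1) (Rg := fun F θ => θ.ZhUnity F 2 ∧ θ.SlotsNondegenerate₁₃ F 2) h14 h15 h18 h22 hD4 h20 h21 hx h19) F θ hP.toCore hG hθ

end Summit.QuantumFields.YangMills.Theorems.BalabanUVNodesN27SpineRecord
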